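import Literature.AnabelianGeometry.EtaleTheta.Discharge.Sec5GaloisShadowOfConnectedTemperoid
import Literature.AnabelianGeometry.EtaleTheta.Discharge.Sec5OfConnectedTemperoid
import Literature.AnabelianGeometry.EtaleTheta.Thm56SubdagStatements
import Literature.AnabelianGeometry.EtaleTheta.ThetaRigidity

/-!
# [EtTh] Thm. 5.6 (i) proof, T56-L02 for the PRODUCED base shadow of `Ψ`: the Galois-shadow binder `hΓ` of the
# Prop. 5.5 ⊕ Thm. 5.6 knit at the genuine §5 data over `B^temp(Π^tp_X)⁰` (K4 «v3c»)

S. Mochizuki, *The étale theta function and its Frobenioid-theoretic manifestations*, Publ. RIMS **45** (2009)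
[MochizukiEtTh2009], Thm. 5.6 proof p.328 (PDF p.102) l.−4 – p.329 l.1: «it follows [cf. Proposition 5.1; [FrdI], Theorem
3.4, (iv), (v)] that `Ψ` … induces a 1-compatible equivalence `Ψ^bs : D ⥲ D`, hence [cf. [SemiAnbd], Proposition 3.2] an outer
automorphism of the tempered fundamental group … In particular, it follows from Propositions 2.4, 2.6 that `Ψ` preserves
"`(l·Δ_Θ)_{(−)}`"»; Cor. 2.18 (i) p.286 (PDF p.60); §5 p.331 (PDF p.105) (`ρ : Π^tp_X ↠ Aut_D(B_N^bs)`, `s^trv_N`).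
S. Mochizuki, *Semi-graphs of anabelioids* [MochizukiSemiAnbd2006], Prop. 3.2 p.35.

abc-iut cell, layer L2, seat abc-iut-w5-d013 (gen 4), ROW «K4 v3c» (named by the K4 custodian abc-iut-w5-d034, STATUS
2026-08-26T07:57:48Z «v3c = γ PRODUCED at the connected data»).  PROOF-ONLY (no definition, no new named fact).
abc-iut-w5-d034's knit `ThetaFrobenioid.exists_rigidityFamily_unique_preserved_ofBiKummerData_of_leaves_model`
(`Discharge/Sec5Thm56OfBiKummerDataAllLeavesV3.lean` p431672; `…V3Pin` p432278) = [EtTh] Prop. 5.5 ⊕ Thm. 5.6 (i) at abc-iut-L2-t4's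
assembled §5 data `𝔉 := ThetaFrobenioid.ofBiKummerData …` modulo named binders, among them the γ-PACKAGE
`hΓ : ∀ θA, (base-shadow law of θA through α) → ∃ γ : Π^tp_X ≃ₜ* Π^tp_X, hγ ∧ hP24 ∧ hγL ∧ haΨ` (`θA` = the base shadow of `Ψ`
at `A_N^bs`, produced existentially by abc-iut-w5-d245's `exists_psiTransportData_ofBiKummerData`).  This file PRODUCES `hΓ`
over the genuine connected base `D := ConnectedPart (BTemp X.Pi) = B^temp(Π^tp_X)⁰` (settings whose Galois data are the
temperoid's — hypothesis `hg`, DEFINITIONAL for `BiKummerSetting.mkOfConnectedTemperoid`) from γ-FREE named inputs: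
* `exists_galoisShadowAN_of_baseShadow` / `exists_galoisShadow_of_baseShadow` — **T56-L02 for the produced shadow**: if `Ψ^bs`
  is an EQUIVALENCE `D ⥲ D` (print; [FrdI] Thm. 3.4 (v)) with `eΨ : Ψ ⋙ Base ≅ Base ⋙ Ψ^bs`, `α : Ψ(A_N) ≅ A_N`, and
  `σ = s^trv_N` is a SECTION of `Aut_C(A_N) → Aut_D(A_N^bs)` (`hσ`; a THEOREM for the constructed `strvOfBiKummerData`), then
  EVERY `θA` satisfying the base-shadow law (p431672's binder verbatim) is of the INDUCED form `g ↦ j⁻¹ ∘ Ψ^bs(g) ∘ j` at the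
  Galois object `A_N^bs` (`j := (eΨ_{A_N})⁻¹ ≫ Base(α)`; the section pins `θA` on all of `Aut_D(A_N^bs)`), so gen 3's
  `GaloisObjects.exists_conj_of_induced_connectedPart` ([SemiAnbd] Prop. 3.2 + `BTemp.exists_equivalence_extension`) yields
  `γ` with `hγ` in p431672's currency `((autBaseIsoAB⁻¹ ∘ θA ∘ autBaseIsoAB)) (ρ y) = ρ (γ y)`;
* `exists_galoisShadow_cor218_of_baseShadow` — `hP24 ∧ hγL` for that `γ` from [EtTh] Cor. 2.18 (i) BY NAME (abc-iut-L2-t2's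
  `RigidData.Cor218_i`: `Π^tp_Ÿ`, `l·Δ_Θ` stable under every topological automorphism of `Π^tp_X` — the packaged form of
  print's «it follows from Propositions 2.4, 2.6»);
* `gammaPackage_of_baseShadow_of_forall` / `gammaPackage_of_baseShadow_of_deltaTransportCompat` — the binder `hΓ` VERBATIM,
  the `haΨ`-conjunct supplied either as a law for every Galois shadow `γ` of `θA`, or from the γ-free typed sub-DAG predicate
  T56-L09c `Thm56Sub.DeltaTransportCompat 𝔉 Ψ β aΨ θ′ P` (abc-iut-w5-d020) for the `B_N`-transport `θ′` of `θA` together with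
  the knit's own binders `hpre`/`hP` (converse of gen 2's `deltaTransportCompat_ofBiKummerData`, p420747);
* `exists_galoisShadow_cor218_ofConnectedTemperoidData` — the literal instance at `ThetaFrobenioid.ofConnectedTemperoidData`
  (`σ := strvOfBiKummerData`, Galois data definitional: arguments `(fun _ hA => ⟨hA, fun _ => rfl⟩) (baseMap_strvOfBiKummerData h R)`,
  the same two arguments instantiate the `gammaPackage_…` producers there); `exists_baseShadowData_refl` — non-vacuity of
  the hypothesis family `(Ψ, Ψ^bs, eΨ, α, θA, law)` (the identity).
NET EFFECT on the (C2) residual of `EtTh:Prop5.5`/`EtTh:Thm5.6(i)` at the connected data: the ∃γ-package `hΓ` is traded for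
{`Ψ^bs` an equivalence with `eΨ` ([FrdI] Thm. 3.4 (v)), `RigidData.Cor218_i` (named fact), T56-L09c (typed, γ-free)}.
HONEST FRAMING: kernel-checked implications; [EtTh] is refereed pre-IUT material; nothing here bears on [IUTchIII] Cor. 3.12;
typed ≠ proved for the named inputs.
-/

noncomputable section

namespace Literature.AnabelianGeometry.EtaleTheta

open CategoryTheory Opposite Literature.AlgebraicGeometry.Frobenioids Literature.AnabelianGeometry.SemiGraphs
  Literature.AnabelianGeometry.SemiGraphs.GaloisObjects FrobenioidCyclotomicRigidity

namespace ThetaFrobenioid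

universe u₀ v₀ w

section General

variable {K : Type u₀} [Field K] {X : SemiGraphs.TemperedArithmeticGroup.{u₀} K} {D₀ : Type u₀} [Category.{v₀} D₀]
  {V : FrdIMonoidStub.{w}} {T₀ : RealifiedDivisorMonoids (D₀ := D₀) V}
  {VD : FrdICatStub.{u₀ + 1, u₀, w} (ConnectedPart (BTemp X.Pi))}
  {S : BiKummerSetting X T₀ (ConnectedPart (BTemp X.Pi)) VD}
  {pullFrac : ∀ {A A' : S.C} (_ : A' ⟶ A), S.biratUnits A → S.biratUnits A'}
  {lv N : ℕ+} {θ : S.biratUnits S.Aodot} {Bl : S.C} {Pl : S.FractionPair θ Bl} {Rl : S.NthRoot θ Pl lv pullFrac}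

section AN

variable {T : ThetaEnvData.{max u₀ w} N}

/-- **[EtTh] Thm. 5.6, T56-L02 for the PRODUCED base shadow, at `A_N^bs`**: over `B^temp(Π^tp_X)⁰` with the temperoid's
Galois data (`hg`), let `Ψ` be a self-equivalence of `C`, `Ψ^bs` an EQUIVALENCE of the base with `eΨ : Ψ ⋙ Base ≅ Base ⋙ Ψ^bs`,
`α : Ψ(A_N) ≅ A_N`, and `σ` a section of `Aut_C(A_N) → Aut_D(A_N^bs)` (`s^trv_N`).  Then every `θA : Aut_D(A_N^bs) ≃ Aut_D(A_N^bs)`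
satisfying the base-shadow law `Base(α⁻¹ ∘ Ψ(f) ∘ α) = θA(Base f)` (`f ∈ Aut_C(A_N)`) is the shadow of a topological
automorphism `γ` of `Π^tp_X`: `θA (ρ_{A_N}(ιX y)) = ρ_{A_N}(ιX (γ y))` — «hence [cf. [SemiAnbd], Prop. 3.2] an outer automorphism of the
tempered fundamental group». [cite: MochizukiEtTh2009, Thm 5.6 proof p.328 (PDF p.102)] -/
theorem exists_galoisShadowAN_of_baseShadow
    (hg : ∀ (A : ConnectedPart (BTemp X.Pi)) (hA : S.IsGaloisObj A), ∃ hA' : SemiGraphs.IsGaloisObj A.obj,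
      ∀ g : X.Pi, (S.galoisSurj A hA g).hom.hom = (galoisSurjOf X.isTempered A.obj hA' g).hom)
    (R : S.NthRoot Rl.root Rl.pair N pullFrac) (ιX : T.PiX ≃ₜ* X.Pi)
    (σ : Aut R.AN.base →* Aut R.AN) (hσ : ∀ g : Aut R.AN.base, ModelFrobenioid.baseMap (σ g).hom = g.hom)
    (Ψ : S.C ≌ S.C) (Ψbs : ConnectedPart (BTemp X.Pi) ⥤ ConnectedPart (BTemp X.Pi)) [Ψbs.IsEquivalence]
    (eΨ : Ψ.functor ⋙ S.base ≅ S.base ⋙ Ψbs)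
    (α : Ψ.functor.obj R.AN ≅ R.AN) (θA : Aut R.AN.base ≃* Aut R.AN.base)
    (hθ : ∀ f : Aut R.AN, (PreFrobenioid.baseFunctor S.F).mapIso (α.symm ≪≫ Ψ.functor.mapIso f ≪≫ α) =
        θA ((PreFrobenioid.baseFunctor S.F).mapIso f)) :
    ∃ γ : T.PiX ≃ₜ* T.PiX, ∀ y : T.PiX,
      θA (S.galoisSurj R.AN.base R.αData.isGalois (ιX y)) = S.galoisSurj R.AN.base R.αData.isGalois (ιX (γ y)) := by
  haveI := X.secondCountableTopology
  -- conjugation as a continuous automorphism of `Π^tp_X`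
  let conjEquiv : X.Pi → (X.Pi ≃ₜ* X.Pi) := fun c =>
    { MulAut.conj c with
      continuous_toFun := by change Continuous fun x => c * x * c⁻¹; fun_prop
      continuous_invFun := by change Continuous fun x => c⁻¹ * x * c; fun_prop }
  have conjEquiv_apply : ∀ c x : X.Pi, conjEquiv c x = c * x * c⁻¹ := fun _ _ => rfl
  obtain ⟨hA', eA⟩ := hg R.AN.base R.αData.isGalois
  -- the component of `eΨ` at `A_N` with objectwise types, and its naturality on endomorphisms of `A_N`
  obtain ⟨ηA, hn⟩ : ∃ ηA : S.base.obj (Ψ.functor.obj R.AN) ≅ Ψbs.obj R.AN.base,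
      ∀ f : R.AN ⟶ R.AN, S.base.map (Ψ.functor.map f) ≫ ηA.hom = ηA.hom ≫ Ψbs.map (ModelFrobenioid.baseMap f) :=
    ⟨eΨ.app R.AN, fun f => eΨ.hom.naturality f⟩
  -- the identification `j : Ψ^bs(A_N^bs) ≅ A_N^bs` through which `θA` is induced
  let j : Ψbs.asEquivalence.functor.obj R.AN.base ≅ R.AN.base := ηA.symm ≪≫ S.base.mapIso α
  have hθ' : ∀ g : Aut R.AN.base, (θA g).hom = j.inv ≫ Ψbs.asEquivalence.functor.map g.hom ≫ j.hom := by
    intro g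
    have key : ∀ f : R.AN ⟶ R.AN, ModelFrobenioid.baseMap f = g.hom →
        S.base.map α.inv ≫ S.base.map (Ψ.functor.map f) ≫ S.base.map α.hom = j.inv ≫ Ψbs.map g.hom ≫ j.hom := by
      intro f hf
      have h4 : S.base.map (Ψ.functor.map f) = ηA.hom ≫ Ψbs.map g.hom ≫ ηA.inv := by
        rw [← hf, ← Category.assoc, ← hn f, Category.assoc, ηA.hom_inv_id, Category.comp_id]
      rw [h4]
      change _ = (S.base.map α.inv ≫ ηA.hom) ≫ Ψbs.map g.hom ≫ ηA.inv ≫ S.base.map α.hom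
      simp only [Category.assoc]
    have h1 : θA g = (PreFrobenioid.baseFunctor S.F).mapIso (α.symm ≪≫ Ψ.functor.mapIso (σ g) ≪≫ α) := by
      rw [hθ (σ g), show (PreFrobenioid.baseFunctor S.F).mapIso (σ g) = g from Iso.ext (hσ g)]
    rw [h1]
    change S.base.map (α.inv ≫ Ψ.functor.map (σ g).hom ≫ α.hom) = _
    rw [Functor.map_comp, Functor.map_comp]
    exact key _ (hσ g)
  -- [SemiAnbd] Prop. 3.2 at the Galois object `A_N^bs` (gen 3)
  obtain ⟨ψ, c, hψ⟩ := exists_conj_of_induced_connectedPart X.isTempered Ψbs.asEquivalence R.AN.base hA'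
    (S.galoisSurj R.AN.base R.αData.isGalois) eA j θA hθ'
  refine ⟨((ιX.trans ψ).trans (conjEquiv c)).trans ιX.symm, fun y => ?_⟩
  rw [hψ]
  simp only [ContinuousMulEquiv.trans_apply, conjEquiv_apply, ContinuousMulEquiv.apply_symm_apply]

/-- **Non-vacuity of the hypothesis family** `(Ψ, Ψ^bs, eΨ, α, θA, base-shadow law)`: the identity self-equivalence with
`Ψ^bs := 𝟭`, `α := 1`, `θA := 1` satisfies the law. [cite: MochizukiEtTh2009, Thm 5.6 proof p.328 (PDF p.102)] -/
theorem exists_baseShadowData_refl (R : S.NthRoot Rl.root Rl.pair N pullFrac) :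
    ∃ (Ψ : S.C ≌ S.C) (Ψbs : ConnectedPart (BTemp X.Pi) ⥤ ConnectedPart (BTemp X.Pi)) (_ : Ψbs.IsEquivalence)
      (_ : Ψ.functor ⋙ S.base ≅ S.base ⋙ Ψbs) (α : Ψ.functor.obj R.AN ≅ R.AN) (θA : Aut R.AN.base ≃* Aut R.AN.base),
      ∀ f : Aut R.AN, (PreFrobenioid.baseFunctor S.F).mapIso (α.symm ≪≫ Ψ.functor.mapIso f ≪≫ α) =
        θA ((PreFrobenioid.baseFunctor S.F).mapIso f) :=
  ⟨CategoryTheory.Equivalence.refl, 𝟭 _, inferInstance, Iso.refl _, Iso.refl _, MulEquiv.refl _, fun f => by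
    apply Iso.ext
    change S.base.map (𝟙 _ ≫ f.hom ≫ 𝟙 _) = S.base.map f.hom
    rw [Category.id_comp, Category.comp_id]⟩

variable (h : ModelFrobenioid.Hypotheses S.tf.divisorMonoid S.tf.ratFnFunctor)
  (toB : ∀ A : S.C, S.biratUnits A →* S.tf.biratUnitsModel A)
  (Q : FrobenioidTheta.ThetaSubquotientStub.{w} (ConnectedPart (BTemp X.Pi))) (odd_l : Odd (lv : ℕ))
  (R : S.NthRoot Rl.root Rl.pair N pullFrac) (ιX : T.PiX ≃ₜ* X.Pi)
  (hopen : IsOpen ((S.galoisSurj R.AN.base R.αData.isGalois).ker : Set X.Pi)) (σ : Aut R.AN.base →* Aut R.AN)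
  (K' : Type w) [Field K'] (constEmb : K'ˣ →* S.tf.biratUnitsModel R.BN) (constEmb_injective : Function.Injective constEmb)
  (hdivc : ∀ g : Aut R.BN.base,
    ModelFrobenioid.div ((σ ((BiKummerSetting.NthRoot.baseIso S R).conjAut.symm g)).hom ≫ R.pair.num) =
      ModelFrobenioid.div R.pair.num)
  (hdivp : ∀ y : T.PiYdd,
    ModelFrobenioid.div ((σ (S.galoisSurj R.AN.base R.αData.isGalois (ιX y.1))).hom ≫ R.pair.den) =
      ModelFrobenioid.div R.pair.den)

/-- **T56-L02 for the PRODUCED base shadow, in the currency of the K4 knit** (p431672's binder `hγ` verbatim): at the assembled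
§5 data `𝔉 := ofBiKummerData …` over `B^temp(Π^tp_X)⁰` (temperoid Galois data `hg`, `σ` a section), for `Ψ^bs` an equivalence
with `eΨ`, `α : Ψ(A_N) ≅ A_N` and every `θA` satisfying the base-shadow law there is `γ : Π^tp_X ≃ₜ* Π^tp_X` with
`(autBaseIsoAB⁻¹ ∘ θA ∘ autBaseIsoAB) (ρ y) = ρ (γ y)` for all `y` (`ρ = rhoOfBiKummerData`, §5 p.331).
[cite: MochizukiEtTh2009, Thm 5.6 proof p.328 (PDF p.102); §5 p.331 (PDF p.105)] -/
theorem exists_galoisShadow_of_baseShadow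
    (hg : ∀ (A : ConnectedPart (BTemp X.Pi)) (hA : S.IsGaloisObj A), ∃ hA' : SemiGraphs.IsGaloisObj A.obj,
      ∀ g : X.Pi, (S.galoisSurj A hA g).hom.hom = (galoisSurjOf X.isTempered A.obj hA' g).hom)
    (hσ : ∀ g : Aut R.AN.base, ModelFrobenioid.baseMap (σ g).hom = g.hom)
    (Ψ : S.C ≌ S.C) (Ψbs : ConnectedPart (BTemp X.Pi) ⥤ ConnectedPart (BTemp X.Pi)) [Ψbs.IsEquivalence]
    (eΨ : Ψ.functor ⋙ (ofBiKummerData h toB Q odd_l R ιX hopen σ K' constEmb constEmb_injective hdivc hdivp).base ≅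
      (ofBiKummerData h toB Q odd_l R ιX hopen σ K' constEmb constEmb_injective hdivc hdivp).base ⋙ Ψbs)
    (α : Ψ.functor.obj (ofBiKummerData h toB Q odd_l R ιX hopen σ K' constEmb constEmb_injective hdivc hdivp).AN ≅
      (ofBiKummerData h toB Q odd_l R ιX hopen σ K' constEmb constEmb_injective hdivc hdivp).AN)
    (θA : Aut R.AN.base ≃* Aut R.AN.base)
    (hθ : ∀ f : Aut R.AN, (PreFrobenioid.baseFunctor S.F).mapIso (α.symm ≪≫ Ψ.functor.mapIso f ≪≫ α) =
        θA ((PreFrobenioid.baseFunctor S.F).mapIso f)) :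
    ∃ γ : T.PiX ≃ₜ* T.PiX, ∀ y : T.PiX,
      (((ofBiKummerData h toB Q odd_l R ιX hopen σ K' constEmb constEmb_injective hdivc hdivp).autBaseIsoAB.symm.trans
          θA).trans (ofBiKummerData h toB Q odd_l R ιX hopen σ K' constEmb constEmb_injective hdivc hdivp).autBaseIsoAB)
        (rhoOfBiKummerData R ιX y) = rhoOfBiKummerData R ιX (γ y) := by
  obtain ⟨γ, hγ⟩ := exists_galoisShadowAN_of_baseShadow hg R ιX σ hσ Ψ Ψbs eΨ α θA hθ
  refine ⟨γ, fun y => ?_⟩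
  change (BiKummerSetting.NthRoot.baseIso S R).conjAut (θA ((BiKummerSetting.NthRoot.baseIso S R).conjAut.symm
    ((BiKummerSetting.NthRoot.baseIso S R).conjAut (S.galoisSurj R.AN.base R.αData.isGalois (ιX y))))) =
    (BiKummerSetting.NthRoot.baseIso S R).conjAut (S.galoisSurj R.AN.base R.αData.isGalois (ιX (γ y)))
  rw [MulEquiv.symm_apply_apply, hγ]

end AN

/-! ### With the §2 rigid data: `hP24`, `hγL` by name (Cor. 2.18 (i)) and the binder `hΓ` -/

section RD

variable {l' : ℕ} {RD : RigidData.{max u₀ w} N l'}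
  (h : ModelFrobenioid.Hypotheses S.tf.divisorMonoid S.tf.ratFnFunctor)
  (toB : ∀ A : S.C, S.biratUnits A →* S.tf.biratUnitsModel A)
  (Q : FrobenioidTheta.ThetaSubquotientStub.{w} (ConnectedPart (BTemp X.Pi))) (odd_l : Odd (lv : ℕ))
  (R : S.NthRoot Rl.root Rl.pair N pullFrac) (ιX : RD.PiX ≃ₜ* X.Pi)
  (hopen : IsOpen ((S.galoisSurj R.AN.base R.αData.isGalois).ker : Set X.Pi)) (σ : Aut R.AN.base →* Aut R.AN)
  (K' : Type w) [Field K'] (constEmb : K'ˣ →* S.tf.biratUnitsModel R.BN) (constEmb_injective : Function.Injective constEmb)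
  (hdivc : ∀ g : Aut R.BN.base,
    ModelFrobenioid.div ((σ ((BiKummerSetting.NthRoot.baseIso S R).conjAut.symm g)).hom ≫ R.pair.num) =
      ModelFrobenioid.div R.pair.num)
  (hdivp : ∀ y : RD.PiYdd,
    ModelFrobenioid.div ((σ (S.galoisSurj R.AN.base R.αData.isGalois (ιX y.1))).hom ≫ R.pair.den) =
      ModelFrobenioid.div R.pair.den)
  (hg : ∀ (A : ConnectedPart (BTemp X.Pi)) (hA : S.IsGaloisObj A), ∃ hA' : SemiGraphs.IsGaloisObj A.obj,
    ∀ g : X.Pi, (S.galoisSurj A hA g).hom.hom = (galoisSurjOf X.isTempered A.obj hA' g).hom)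
  (hσ : ∀ g : Aut R.AN.base, ModelFrobenioid.baseMap (σ g).hom = g.hom)
  (h218 : RD.Cor218_i)

include hg hσ h218

/-- **T56-L02 ⊕ «Propositions 2.4, 2.6» (through Cor. 2.18 (i) BY NAME) for the produced base shadow**: the Galois shadow `γ`
of `θA` with `hγ`, and `γ(Π^tp_Ÿ) = Π^tp_Ÿ` (`hP24`), `γ(l·Δ_Θ) = l·Δ_Θ` (`hγL`) — the latter two are instances of
abc-iut-L2-t2's named fact `RigidData.Cor218_i` at `γ`. [cite: MochizukiEtTh2009, Thm 5.6 proof p.328–329 (PDF pp.102–103); Cor 2.18 (i) p.286 (PDF p.60)] -/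
theorem exists_galoisShadow_cor218_of_baseShadow
    (Ψ : S.C ≌ S.C) (Ψbs : ConnectedPart (BTemp X.Pi) ⥤ ConnectedPart (BTemp X.Pi)) [Ψbs.IsEquivalence]
    (eΨ : Ψ.functor ⋙ (ofBiKummerData h toB Q odd_l R ιX hopen σ K' constEmb constEmb_injective hdivc hdivp).base ≅
      (ofBiKummerData h toB Q odd_l R ιX hopen σ K' constEmb constEmb_injective hdivc hdivp).base ⋙ Ψbs)
    (α : Ψ.functor.obj (ofBiKummerData h toB Q odd_l R ιX hopen σ K' constEmb constEmb_injective hdivc hdivp).AN ≅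
      (ofBiKummerData h toB Q odd_l R ιX hopen σ K' constEmb constEmb_injective hdivc hdivp).AN)
    (θA : Aut R.AN.base ≃* Aut R.AN.base)
    (hθ : ∀ f : Aut R.AN, (PreFrobenioid.baseFunctor S.F).mapIso (α.symm ≪≫ Ψ.functor.mapIso f ≪≫ α) =
        θA ((PreFrobenioid.baseFunctor S.F).mapIso f)) :
    ∃ γ : RD.PiX ≃ₜ* RD.PiX,
      (∀ y : RD.PiX,
        (((ofBiKummerData h toB Q odd_l R ιX hopen σ K' constEmb constEmb_injective hdivc hdivp).autBaseIsoAB.symm.trans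
            θA).trans (ofBiKummerData h toB Q odd_l R ιX hopen σ K' constEmb constEmb_injective hdivc hdivp).autBaseIsoAB)
          (rhoOfBiKummerData R ιX y) = rhoOfBiKummerData R ιX (γ y)) ∧
      RD.PiYdd.map γ.toMulEquiv.toMonoidHom = RD.PiYdd ∧
      RD.lDeltaTheta.map γ.toMulEquiv.toMonoidHom = RD.lDeltaTheta := by
  obtain ⟨γ, hγ⟩ := exists_galoisShadow_of_baseShadow h toB Q odd_l R ιX hopen σ K' constEmb constEmb_injective hdivc
    hdivp hg hσ Ψ Ψbs eΨ α θA hθ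
  exact ⟨γ, hγ, (h218 γ).2.1, (h218 γ).2.2.2.2.1⟩

/-- **The binder `hΓ` of the K4 knit PRODUCED — `haΨ` supplied as a law for every Galois shadow** (T56-L03/L09c: the
`B_N`-reading of abc-iut-L2-d4's Δ-transport `aΨ` through `β` is induced by any `γ` shadowing `θA`; a γ-free input since the
law is quantified over all shadows). [cite: MochizukiEtTh2009, Thm 5.6 proof p.328–329 (PDF pp.102–103)] -/
theorem gammaPackage_of_baseShadow_of_forall
    (Ψ : S.C ≌ S.C) (Ψbs : ConnectedPart (BTemp X.Pi) ⥤ ConnectedPart (BTemp X.Pi)) [Ψbs.IsEquivalence]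
    (eΨ : Ψ.functor ⋙ (ofBiKummerData h toB Q odd_l R ιX hopen σ K' constEmb constEmb_injective hdivc hdivp).base ≅
      (ofBiKummerData h toB Q odd_l R ιX hopen σ K' constEmb constEmb_injective hdivc hdivp).base ⋙ Ψbs)
    (α : Ψ.functor.obj (ofBiKummerData h toB Q odd_l R ιX hopen σ K' constEmb constEmb_injective hdivc hdivp).AN ≅
      (ofBiKummerData h toB Q odd_l R ιX hopen σ K' constEmb constEmb_injective hdivc hdivp).AN)
    (e : RD.mu → (ofBiKummerData h toB Q odd_l R ιX hopen σ K' constEmb constEmb_injective hdivc hdivp).lDeltaModN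
      (ofBiKummerData h toB Q odd_l R ιX hopen σ K' constEmb constEmb_injective hdivc hdivp).BN)
    (β : Ψ.functor.obj (ofBiKummerData h toB Q odd_l R ιX hopen σ K' constEmb constEmb_injective hdivc hdivp).BN ≅
      (ofBiKummerData h toB Q odd_l R ιX hopen σ K' constEmb constEmb_injective hdivc hdivp).BN)
    (aΨ : ∀ A : S.C, (ofBiKummerData h toB Q odd_l R ιX hopen σ K' constEmb constEmb_injective hdivc hdivp).lDeltaModN A ≃*
      (ofBiKummerData h toB Q odd_l R ιX hopen σ K' constEmb constEmb_injective hdivc hdivp).lDeltaModN (Ψ.functor.obj A))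
    (haΨ' : ∀ θA : Aut R.AN.base ≃* Aut R.AN.base,
      (∀ f : Aut R.AN, (PreFrobenioid.baseFunctor S.F).mapIso (α.symm ≪≫ Ψ.functor.mapIso f ≪≫ α) =
        θA ((PreFrobenioid.baseFunctor S.F).mapIso f)) →
      ∀ γ : RD.PiX ≃ₜ* RD.PiX,
        (∀ y : RD.PiX,
          (((ofBiKummerData h toB Q odd_l R ιX hopen σ K' constEmb constEmb_injective hdivc hdivp).autBaseIsoAB.symm.trans
              θA).trans (ofBiKummerData h toB Q odd_l R ιX hopen σ K' constEmb constEmb_injective hdivc hdivp).autBaseIsoAB)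
            (rhoOfBiKummerData R ιX y) = rhoOfBiKummerData R ιX (γ y)) →
        ∀ (k : RD.PiYdd) (hk : (k : RD.PiX) ∈ RD.lDeltaTheta) (hk' : γ k ∈ RD.lDeltaTheta),
          (ofBiKummerData h toB Q odd_l R ιX hopen σ K' constEmb constEmb_injective hdivc hdivp).lDeltaModNMap β.hom
              (aΨ _ (e (RD.thetaMod ⟨k, hk⟩))) = e (RD.thetaMod ⟨γ k, hk'⟩)) :
    ∀ θA : Aut R.AN.base ≃* Aut R.AN.base,
      (∀ f : Aut R.AN, (PreFrobenioid.baseFunctor S.F).mapIso (α.symm ≪≫ Ψ.functor.mapIso f ≪≫ α) =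
        θA ((PreFrobenioid.baseFunctor S.F).mapIso f)) →
      ∃ γ : RD.PiX ≃ₜ* RD.PiX,
        (∀ y : RD.PiX,
          (((ofBiKummerData h toB Q odd_l R ιX hopen σ K' constEmb constEmb_injective hdivc hdivp).autBaseIsoAB.symm.trans
              θA).trans (ofBiKummerData h toB Q odd_l R ιX hopen σ K' constEmb constEmb_injective hdivc hdivp).autBaseIsoAB)
            (rhoOfBiKummerData R ιX y) = rhoOfBiKummerData R ιX (γ y)) ∧
        RD.PiYdd.map γ.toMulEquiv.toMonoidHom = RD.PiYdd ∧
        RD.lDeltaTheta.map γ.toMulEquiv.toMonoidHom = RD.lDeltaTheta ∧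
        ∀ (k : RD.PiYdd) (hk : (k : RD.PiX) ∈ RD.lDeltaTheta) (hk' : γ k ∈ RD.lDeltaTheta),
          (ofBiKummerData h toB Q odd_l R ιX hopen σ K' constEmb constEmb_injective hdivc hdivp).lDeltaModNMap β.hom
              (aΨ _ (e (RD.thetaMod ⟨k, hk⟩))) = e (RD.thetaMod ⟨γ k, hk'⟩) := by
  intro θA hθ
  obtain ⟨γ, hγ, hP24, hγL⟩ := exists_galoisShadow_cor218_of_baseShadow h toB Q odd_l R ιX hopen σ K' constEmb
    constEmb_injective hdivc hdivp hg hσ h218 Ψ Ψbs eΨ α θA hθ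
  exact ⟨γ, hγ, hP24, hγL, haΨ' θA hθ γ hγ⟩

/-- **The binder `hΓ` of the K4 knit PRODUCED — `haΨ` from the γ-FREE typed T56-L09c predicate** `Thm56Sub.DeltaTransportCompat`
(abc-iut-w5-d020) for the `B_N`-transport `θ′ := autBaseIsoAB⁻¹-conjugate of θA` of each admissible base shadow, together with the
knit's own binders `hpre` / `hP` (the real subquotient datum at `B_N^bs` reads `l·Δ_Θ` through `ρ`): since `θ′ (ρ k) = ρ (γ k)`,
compatibility of `aΨ` with `θ′` on `P.pre` IS compatibility with `γ` on `l·Δ_Θ ∩ Π^tp_Ÿ`.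
[cite: MochizukiEtTh2009, Thm 5.6 proof p.329 (PDF p.103)] -/
theorem gammaPackage_of_baseShadow_of_deltaTransportCompat
    (Ψ : S.C ≌ S.C) (Ψbs : ConnectedPart (BTemp X.Pi) ⥤ ConnectedPart (BTemp X.Pi)) [Ψbs.IsEquivalence]
    (eΨ : Ψ.functor ⋙ (ofBiKummerData h toB Q odd_l R ιX hopen σ K' constEmb constEmb_injective hdivc hdivp).base ≅
      (ofBiKummerData h toB Q odd_l R ιX hopen σ K' constEmb constEmb_injective hdivc hdivp).base ⋙ Ψbs)
    (α : Ψ.functor.obj (ofBiKummerData h toB Q odd_l R ιX hopen σ K' constEmb constEmb_injective hdivc hdivp).AN ≅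
      (ofBiKummerData h toB Q odd_l R ιX hopen σ K' constEmb constEmb_injective hdivc hdivp).AN)
    (e : RD.mu → (ofBiKummerData h toB Q odd_l R ιX hopen σ K' constEmb constEmb_injective hdivc hdivp).lDeltaModN
      (ofBiKummerData h toB Q odd_l R ιX hopen σ K' constEmb constEmb_injective hdivc hdivp).BN)
    (P : ThetaSubquotientProj (ofBiKummerData h toB Q odd_l R ιX hopen σ K' constEmb constEmb_injective hdivc hdivp))
    (hpre : ∀ k : RD.PiYdd, (k : RD.PiX) ∈ RD.lDeltaTheta → rhoOfBiKummerData R ιX k ∈ P.pre _)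
    (hP : ∀ (k : RD.PiYdd) (hk : (k : RD.PiX) ∈ RD.lDeltaTheta) (hm : rhoOfBiKummerData R ιX k ∈ P.pre _),
      (QuotientGroup.mk (P.proj _ ⟨rhoOfBiKummerData R ιX k, hm⟩) :
          (ofBiKummerData h toB Q odd_l R ιX hopen σ K' constEmb constEmb_injective hdivc hdivp).lDeltaModN
            (ofBiKummerData h toB Q odd_l R ιX hopen σ K' constEmb constEmb_injective hdivc hdivp).BN) =
        e (RD.thetaMod ⟨k, hk⟩))
    (β : Ψ.functor.obj (ofBiKummerData h toB Q odd_l R ιX hopen σ K' constEmb constEmb_injective hdivc hdivp).BN ≅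
      (ofBiKummerData h toB Q odd_l R ιX hopen σ K' constEmb constEmb_injective hdivc hdivp).BN)
    (aΨ : ∀ A : S.C, (ofBiKummerData h toB Q odd_l R ιX hopen σ K' constEmb constEmb_injective hdivc hdivp).lDeltaModN A ≃*
      (ofBiKummerData h toB Q odd_l R ιX hopen σ K' constEmb constEmb_injective hdivc hdivp).lDeltaModN (Ψ.functor.obj A))
    (hΔ : ∀ θA : Aut R.AN.base ≃* Aut R.AN.base,
      (∀ f : Aut R.AN, (PreFrobenioid.baseFunctor S.F).mapIso (α.symm ≪≫ Ψ.functor.mapIso f ≪≫ α) =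
        θA ((PreFrobenioid.baseFunctor S.F).mapIso f)) →
      Thm56Sub.DeltaTransportCompat (ofBiKummerData h toB Q odd_l R ιX hopen σ K' constEmb constEmb_injective hdivc hdivp)
        Ψ β aΨ
        (((ofBiKummerData h toB Q odd_l R ιX hopen σ K' constEmb constEmb_injective hdivc hdivp).autBaseIsoAB.symm.trans
            θA).trans (ofBiKummerData h toB Q odd_l R ιX hopen σ K' constEmb constEmb_injective hdivc hdivp).autBaseIsoAB)
        P) :
    ∀ θA : Aut R.AN.base ≃* Aut R.AN.base,
      (∀ f : Aut R.AN, (PreFrobenioid.baseFunctor S.F).mapIso (α.symm ≪≫ Ψ.functor.mapIso f ≪≫ α) =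
        θA ((PreFrobenioid.baseFunctor S.F).mapIso f)) →
      ∃ γ : RD.PiX ≃ₜ* RD.PiX,
        (∀ y : RD.PiX,
          (((ofBiKummerData h toB Q odd_l R ιX hopen σ K' constEmb constEmb_injective hdivc hdivp).autBaseIsoAB.symm.trans
              θA).trans (ofBiKummerData h toB Q odd_l R ιX hopen σ K' constEmb constEmb_injective hdivc hdivp).autBaseIsoAB)
            (rhoOfBiKummerData R ιX y) = rhoOfBiKummerData R ιX (γ y)) ∧
        RD.PiYdd.map γ.toMulEquiv.toMonoidHom = RD.PiYdd ∧
        RD.lDeltaTheta.map γ.toMulEquiv.toMonoidHom = RD.lDeltaTheta ∧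
        ∀ (k : RD.PiYdd) (hk : (k : RD.PiX) ∈ RD.lDeltaTheta) (hk' : γ k ∈ RD.lDeltaTheta),
          (ofBiKummerData h toB Q odd_l R ιX hopen σ K' constEmb constEmb_injective hdivc hdivp).lDeltaModNMap β.hom
              (aΨ _ (e (RD.thetaMod ⟨k, hk⟩))) = e (RD.thetaMod ⟨γ k, hk'⟩) := by
  refine gammaPackage_of_baseShadow_of_forall h toB Q odd_l R ιX hopen σ K' constEmb constEmb_injective hdivc hdivp hg hσ h218 Ψ Ψbs eΨ
    α e β aΨ fun θA hθ γ hγ k hk hk' => ?_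
  -- membership in `θ⁻¹(l·Δ_Θ)` forces membership in `Π^tp_Ÿ` (Prop. 2.14 (i): `(l·Δ_Θ) ⊆ (Δ^tp_Ÿ)^Θ`)
  have hY : (γ k : RD.PiX) ∈ RD.PiYdd := (Subgroup.mem_inf.mp (RD.lDeltaTheta_le hk')).1
  obtain ⟨hθg, hcompat⟩ := hΔ θA hθ (rhoOfBiKummerData R ιX k) (hpre k hk)
  have hm' : rhoOfBiKummerData R ιX (⟨γ k, hY⟩ : RD.PiYdd) ∈ P.pre _ := hpre ⟨γ k, hY⟩ hk'
  rw [← hP k hk (hpre k hk), hcompat, ← hP ⟨γ k, hY⟩ hk' hm']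
  congr 2
  exact Subtype.ext (hγ k)

end RD

end General

/-! ### The literal instances at abc-iut-L2-t4's `ThetaFrobenioid.ofConnectedTemperoidData` -/

section ConnectedTemperoidData

variable {K : Type u₀} [Field K] {X : SemiGraphs.TemperedArithmeticGroup.{u₀} K} {D₀ : Type u₀} [Category.{v₀} D₀]
  {V : FrdIMonoidStub.{w}} {T₀ : RealifiedDivisorMonoids (D₀ := D₀) V}
  {VD : FrdICatStub.{u₀ + 1, u₀, w} (ConnectedPart (BTemp X.Pi))}
  {tf : TemperedFrobenioid T₀ (ConnectedPart (BTemp X.Pi)) VD} {hZ : tf.monoidType = MonoidType.Z}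
  {hP : ∀ A : (ConnectedPart (BTemp X.Pi))ᵒᵖ, IsPerfect (tf.Φ.carrier A)}
  {NH : Subgroup (Field.absoluteGaloisGroup K) → tf.category → ℕ+ → Prop} {A₀ : tf.category}
  {hA₀ : PreFrobenioid.IsFrobeniusTrivial tf.toElem A₀} {hA₀' : SemiGraphs.IsGaloisObj A₀.base.obj}
  {lv N : ℕ+} {l' : ℕ} {RD : RigidData.{max u₀ w} N l'}
  {pullFrac : ∀ {A A' : (BiKummerSetting.mkOfConnectedTemperoid X tf hZ hP NH A₀ hA₀ hA₀').C} (_ : A' ⟶ A),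
    (BiKummerSetting.mkOfConnectedTemperoid X tf hZ hP NH A₀ hA₀ hA₀').biratUnits A →
      (BiKummerSetting.mkOfConnectedTemperoid X tf hZ hP NH A₀ hA₀ hA₀').biratUnits A'}
  {θ : (BiKummerSetting.mkOfConnectedTemperoid X tf hZ hP NH A₀ hA₀ hA₀').biratUnits
    (BiKummerSetting.mkOfConnectedTemperoid X tf hZ hP NH A₀ hA₀ hA₀').Aodot}
  {Bl : (BiKummerSetting.mkOfConnectedTemperoid X tf hZ hP NH A₀ hA₀ hA₀').C}
  {Pl : (BiKummerSetting.mkOfConnectedTemperoid X tf hZ hP NH A₀ hA₀ hA₀').FractionPair θ Bl}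
  {Rl : (BiKummerSetting.mkOfConnectedTemperoid X tf hZ hP NH A₀ hA₀ hA₀').NthRoot θ Pl lv pullFrac}
  (h : ModelFrobenioid.Hypotheses tf.divisorMonoid tf.ratFnFunctor)
  (Q : FrobenioidTheta.ThetaSubquotientStub.{w} (ConnectedPart (BTemp X.Pi))) (odd_l : Odd (lv : ℕ))
  (R : (BiKummerSetting.mkOfConnectedTemperoid X tf hZ hP NH A₀ hA₀ hA₀').NthRoot Rl.root Rl.pair N pullFrac)
  (ιX : RD.PiX ≃ₜ* X.Pi) (K' : Type w) [Field K'] (constEmb : K'ˣ →* tf.biratUnitsModel R.BN)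
  (constEmb_injective : Function.Injective constEmb)
  (hinvc : ∀ g : Aut R.AN.base,
    pull tf.divisorMonoid g.hom (ModelFrobenioid.div R.pair.num) = ModelFrobenioid.div R.pair.num)
  (hinvp : ∀ y : RD.PiX, y ∈ RD.PiYdd →
    pull tf.divisorMonoid ((BiKummerSetting.mkOfConnectedTemperoid X tf hZ hP NH A₀ hA₀ hA₀').galoisSurj R.AN.base
      R.αData.isGalois (ιX y)).hom (ModelFrobenioid.div R.pair.den) = ModelFrobenioid.div R.pair.den)
  (h218 : RD.Cor218_i)

include h218

/-- **T56-L02 ⊕ Cor. 2.18 (i) for the produced base shadow, at the genuine §5 data over `B^temp(Π^tp_X)⁰`** — `σ := s^trv_N`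
CONSTRUCTED (`strvOfBiKummerData`, its section law the theorem `baseMap_strvOfBiKummerData`), Galois data the temperoid's
(definitional): for `Ψ^bs` an equivalence with `eΨ`, `α`, and every `θA` with the base-shadow law, `∃ γ` with `hγ ∧ hP24 ∧ hγL`.
[cite: MochizukiEtTh2009, Thm 5.6 proof p.328–329 (PDF pp.102–103); Cor 2.18 (i) p.286 (PDF p.60)] -/
theorem exists_galoisShadow_cor218_ofConnectedTemperoidData
    (Ψ : (BiKummerSetting.mkOfConnectedTemperoid X tf hZ hP NH A₀ hA₀ hA₀').C ≌
      (BiKummerSetting.mkOfConnectedTemperoid X tf hZ hP NH A₀ hA₀ hA₀').C)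
    (Ψbs : ConnectedPart (BTemp X.Pi) ⥤ ConnectedPart (BTemp X.Pi)) [Ψbs.IsEquivalence]
    (eΨ : Ψ.functor ⋙ (ofConnectedTemperoidData h Q odd_l R ιX K' constEmb constEmb_injective hinvc hinvp).base ≅
      (ofConnectedTemperoidData h Q odd_l R ιX K' constEmb constEmb_injective hinvc hinvp).base ⋙ Ψbs)
    (α : Ψ.functor.obj (ofConnectedTemperoidData h Q odd_l R ιX K' constEmb constEmb_injective hinvc hinvp).AN ≅
      (ofConnectedTemperoidData h Q odd_l R ιX K' constEmb constEmb_injective hinvc hinvp).AN)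
    (θA : Aut R.AN.base ≃* Aut R.AN.base)
    (hθ : ∀ f : Aut R.AN, (PreFrobenioid.baseFunctor (BiKummerSetting.mkOfConnectedTemperoid X tf hZ hP NH A₀ hA₀ hA₀').F).mapIso
        (α.symm ≪≫ Ψ.functor.mapIso f ≪≫ α) =
        θA ((PreFrobenioid.baseFunctor (BiKummerSetting.mkOfConnectedTemperoid X tf hZ hP NH A₀ hA₀ hA₀').F).mapIso f)) :
    ∃ γ : RD.PiX ≃ₜ* RD.PiX,
      (∀ y : RD.PiX,
        (((ofConnectedTemperoidData h Q odd_l R ιX K' constEmb constEmb_injective hinvc hinvp).autBaseIsoAB.symm.trans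
            θA).trans (ofConnectedTemperoidData h Q odd_l R ιX K' constEmb constEmb_injective hinvc hinvp).autBaseIsoAB)
          (rhoOfBiKummerData R ιX y) = rhoOfBiKummerData R ιX (γ y)) ∧
      RD.PiYdd.map γ.toMulEquiv.toMonoidHom = RD.PiYdd ∧
      RD.lDeltaTheta.map γ.toMulEquiv.toMonoidHom = RD.lDeltaTheta :=
  exists_galoisShadow_cor218_of_baseShadow h _ Q odd_l R ιX _ _ K' constEmb constEmb_injective _ _
    (fun _ hA => ⟨hA, fun _ => rfl⟩) (baseMap_strvOfBiKummerData h R) h218 Ψ Ψbs eΨ α θA hθ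

end ConnectedTemperoidData

end ThetaFrobenioid

end Literature.AnabelianGeometry.EtaleTheta

end
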